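import Summits.Ventures.LatticeQCDFlow.TrivializingMaps.WilsonSU2FisherZeroRadius
import Summits.Ventures.LatticeQCDFlow.TrivializingMaps.HaarTraceMomentsSUn
import Literature.Analysis.Complex.BorelCaratheodoryDeriv

/-!
HONEST FRAMING: exact (Metropolis-corrected) sampling algorithms for lattice gauge theory; figures
of merit are autocorrelation/cost numbers at stated couplings and volumes; no continuum-physics
claim.

# FisherZeroRadiusSharp — the zero-free radius of a Laplace transform is at most
# `4 · (half-range) / variance`; every finite-volume `SU(2)` Wilson partition function has a Fisher
# zero with `|s| ≤ 8`, every `SU(n)` one (`n ≥ 3`) with `|s| ≤ 8n` (lean-2 GEN-7, ours)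

Venture-side (OURS).  Cell `lqcd-flow` (pub-lqcd), unit `pub-lqcd-lean-2-g7`, 2026-08-22.

`FisherZeroRadiusBound` (GEN-6) turned zero-freeness of `Z(z) = ∫ e^{zX} dμ` on `|z| < R` into
`Var X ≤ 128(|b|R + 1)/R²` by Borel–Carathéodory for the MODULUS of `log Z` on `|z| ≤ R/2` followed
by two Cauchy estimates.  The loss is entirely in that route: the COEFFICIENT form of the
Borel–Carathéodory lemma (Montgomery–Vaughan, Lemma 6.2, eq. (6.1), now
`Literature.Analysis.Complex.borelCaratheodory_norm_iteratedDeriv_le_of_ball`) bounds the second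
Taylor coefficient of `log Z` directly: `Re log Z(z) = log |Z(z)| ≤ |b|·|z| ≤ |b|R` and
`(log Z)''(0) = Var X` give

* **`variance_le_four_mul_div_of_zeroFree_ball`** — `|X − c| ≤ b` a.e. and `Z` zero-free on
  `|z| < R` `⇒ Var X ≤ 4|b|/R` (any centre `c`: the zeros of `Z` do not move under `X ↦ X − c`);
* **`exists_zero_norm_lt_of_lt_variance`** — `4|b|/R < Var X ⇒` a zero with `|z| < R`;
* **`exists_zero_norm_le_of_variance_pos`** — `Var X > 0 ⇒` a zero with `|z| ≤ 4|b| / Var X`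
  (closed form, by compactness of the zero set in a disc).

The scale is right: for a fair sign `X = ±1` (`b = 1`, `Var X = 1`) `Z = cosh` has its first zeros at
`±iπ/2`, distance `1.5707…`, and the theorem gives `≤ 4`.

Docked to lattice gauge theory (`Z_L(s) = ∫ D[U] e^{-sS}`): `exists_actionZ_eq_zero_norm_le` for any
smooth action, and for the `SU(n)` Wilson action `S_W = ∑_p Re tr(1 − U_p)` — centre `n·#plaq`,
half-range `n·#plaq` (`0 ≤ S_W ≤ 2n·#plaq`), `Var_{D[U]}(S_W) = m₂(n)·#plaq`
(`WilsonVarianceExtensive`) —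

* **`wilson_exists_fisherZero_norm_le`** — every `Z_{d,L,n}` (`d ≥ 2`, `L ≥ 2`, `n ≥ 2`) has a zero
  with `|s₀| ≤ 4n/m₂(n)`; **`wilson_su2_exists_fisherZero_norm_le` — `|s₀| ≤ 8` for `SU(2)`**
  (`m₂(2) = 1`); **`wilson_sun_exists_fisherZero_norm_le` — `|s₀| ≤ 8n` for `n ≥ 3`** (`m₂(n) = ½`);
* **`wilson_theoremA_radius_le_sharp` / `_su2` / `_sun`** — every radius `ρ` of a THEOREM-A-type
  volume-uniform geometric gradient bound for the Lüscher series of `S_W` obeys `ρ ≤ 4n/m₂(n)`,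
  `ρ ≤ 8` (`SU(2)`), `ρ ≤ 8n` (`n ≥ 3`) — replacing GEN-6's `1280` and `512(2n+1)`.

In the conventional normalisation `β ∑_p (1 − (1/n) Re tr U_p)` the coupling is `β = n s`, so the
`SU(2)` disc is `|β| ≤ 16` and the `SU(3)` disc `|β| ≤ 72`.  NOT CLAIMED: sharpness of `8` / `8n`
(printed MCMC-located zeros of small-volume `SU(2)`/`SU(3)` partition functions sit at `|s|` of order
one); `L = 1`; anything at `β ≠ 0`; cost / autocorrelation / continuum statements.
-/

open MeasureTheory ProbabilityTheory Filter Topology Complex Set Metric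
open Literature.MathematicalPhysics.QuantumFieldTheory
open Literature.MathematicalPhysics.QuantumFieldTheory.Luscher2010
open Literature.MathematicalPhysics.QuantumFieldTheory.WilsonFlow (coeConfig continuous_coeConfig)
open Literature.NumberTheory.LFunctions.InvZetaRH (exists_log_of_ball)
open Literature.Analysis.Complex (borelCaratheodory_norm_iteratedDeriv_le_of_ball)
open scoped Matrix Matrix.Norms.Frobenius ContDiff

namespace Summit.Ventures.LatticeQCDFlow.TrivializingMaps

/-! ## §1 The sharp zero-free ⟹ small-variance inequality -/

section General

variable {Ω : Type*} [MeasurableSpace Ω] {μ : Measure Ω} [IsProbabilityMeasure μ]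
  {X : Ω → ℝ} {b c : ℝ}

/-- Shifting a random variable multiplies its complex MGF by a zero-free exponential:
`∫ e^{z(X−c)} dμ = e^{−zc} ∫ e^{zX} dμ`. [folklore] -/
theorem complexMGF_sub_const (X : Ω → ℝ) (μ : Measure Ω) (c : ℝ) (z : ℂ) :
    complexMGF (fun u => X u - c) μ z = exp (-(z * c)) * complexMGF X μ z := by
  unfold complexMGF
  rw [← integral_const_mul]
  refine integral_congr_ae (ae_of_all _ fun u => ?_)
  simp only [Complex.ofReal_sub]
  rw [mul_sub, sub_eq_neg_add, Complex.exp_add]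

/-- **Zero-free disc ⟹ small variance, sharp form.**  If `|X| ≤ b` a.e. under a probability
measure and `z ↦ ∫ e^{zX} dμ` has no zero on `|z| < R` (`R > 0`), then `Var X ≤ 4|b|/R`.
(Holomorphic logarithm `L` on the disc, `Re L(z) = log|Z(z)| ≤ |b|R`, the `k = 2` coefficient form of
Borel–Carathéodory `|L''(0)| ≤ 4·|b|R/R²`, and `L''(0) = (Z′/Z)′(0) = Var X`.) [ours] -/
theorem variance_le_four_mul_div_of_zeroFree_ball₀ (hm : AEMeasurable X μ)
    (hb : ∀ᵐ u ∂μ, |X u| ≤ b) {R : ℝ} (hR : 0 < R)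
    (hfree : ∀ z ∈ ball (0 : ℂ) R, complexMGF X μ z ≠ 0) :
    variance X μ ≤ 4 * |b| / R := by
  set Z := complexMGF X μ with hZdef
  set G : ℂ → ℂ := fun w => deriv Z w / Z w with hGdef
  have hZd : Differentiable ℂ Z := ZeroPinching.differentiable_complexMGF_of_abs_le hm hb
  have hZ0 : Z 0 = 1 := by
    rw [hZdef, show (0 : ℂ) = ((0 : ℝ) : ℂ) from Complex.ofReal_zero.symm, complexMGF_ofReal,
      mgf_zero]
    simp
  set B : ℝ := |b| with hBdef
  have hB0 : 0 ≤ B := abs_nonneg b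
  have hgrowth : ∀ z : ℂ, ‖Z z‖ ≤ Real.exp (B * ‖z‖) := fun z => by
    refine (norm_complexMGF_le_mgf).trans
      ((ZeroPinching.mgf_le_exp_of_abs_le hm hb z.re).trans ?_)
    refine Real.exp_le_exp.mpr ?_
    calc |z.re| * b ≤ |z.re| * B := mul_le_mul_of_nonneg_left (le_abs_self b) (abs_nonneg _)
      _ ≤ ‖z‖ * B := mul_le_mul_of_nonneg_right (abs_re_le_norm z) hB0
      _ = B * ‖z‖ := mul_comm _ _
  -- holomorphic logarithm on the zero-free disc
  obtain ⟨L, hLd, hL0, hLder, hLexp⟩ :=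
    exists_log_of_ball (c := (0 : ℂ)) hR hZd.differentiableOn hfree
  have hL00 : L 0 = 0 := by rw [hL0, hZ0, Complex.log_one]
  have hre : ∀ z ∈ ball (0 : ℂ) R, (L z).re ≤ B * R := by
    intro z hz
    have hzR : ‖z‖ < R := mem_ball_zero_iff.mp hz
    have h1 : Real.exp (L z).re = ‖Z z‖ := by rw [← hLexp z hz, Complex.norm_exp]
    have h2 : Real.exp (L z).re ≤ Real.exp (B * R) := by
      rw [h1]
      exact (hgrowth z).trans (Real.exp_le_exp.mpr (mul_le_mul_of_nonneg_left hzR.le hB0))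
    exact Real.exp_le_exp.mp h2
  -- the `k = 2` coefficient bound
  have hcoef := borelCaratheodory_norm_iteratedDeriv_le_of_ball hR hLd hre hL00 (k := 2)
    (by norm_num)
  have hLG : iteratedDeriv 2 L 0 = deriv G 0 := by
    rw [iteratedDeriv_succ, iteratedDeriv_one]
    refine Filter.EventuallyEq.deriv_eq ?_
    filter_upwards [isOpen_ball.mem_nhds (mem_ball_self hR)] with z hz using (hLder z hz).deriv
  have hG0 : deriv G 0 = ((variance X μ : ℝ) : ℂ) := deriv_logDeriv_complexMGF_zero hm hb
  rw [hLG, hG0, Complex.norm_real, Real.norm_eq_abs, abs_of_nonneg (variance_nonneg X μ)] at hcoef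
  calc variance X μ ≤ 2 * (Nat.factorial 2 : ℕ) * (B * R) / R ^ 2 := hcoef
    _ = 4 * B / R := by
        rw [show (Nat.factorial 2 : ℕ) = 2 by rfl]
        push_cast
        field_simp
        ring

/-- **Zero-free disc ⟹ small variance, sharp centred form.**  If `|X − c| ≤ b` a.e. (so `b` is a
half-range of `X`) and `z ↦ ∫ e^{zX} dμ` has no zero on `|z| < R` (`R > 0`), then `Var X ≤ 4|b|/R`.
[ours] -/
theorem variance_le_four_mul_div_of_zeroFree_ball (hm : AEMeasurable X μ)
    (hb : ∀ᵐ u ∂μ, |X u - c| ≤ b) {R : ℝ} (hR : 0 < R)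
    (hfree : ∀ z ∈ ball (0 : ℂ) R, complexMGF X μ z ≠ 0) :
    variance X μ ≤ 4 * |b| / R := by
  have hm' : AEMeasurable (fun u => X u - c) μ := hm.sub_const c
  have hfree' : ∀ z ∈ ball (0 : ℂ) R, complexMGF (fun u => X u - c) μ z ≠ 0 := fun z hz => by
    rw [complexMGF_sub_const]
    exact mul_ne_zero (Complex.exp_ne_zero _) (hfree z hz)
  have h := variance_le_four_mul_div_of_zeroFree_ball₀ hm' hb hR hfree'
  rwa [variance_sub_const hm.aestronglyMeasurable] at h

/-- **A zero within radius `R` from the variance (sharp form).**  `|X − c| ≤ b` a.e. and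
`4|b|/R < Var X` `⇒` the complex MGF of `X` vanishes at some `|z| < R`. [ours] -/
theorem exists_zero_norm_lt_of_lt_variance (hm : AEMeasurable X μ)
    (hb : ∀ᵐ u ∂μ, |X u - c| ≤ b) {R : ℝ} (hR : 0 < R) (hvar : 4 * |b| / R < variance X μ) :
    ∃ z : ℂ, ‖z‖ < R ∧ complexMGF X μ z = 0 := by
  by_contra hcon
  have hfree : ∀ z ∈ ball (0 : ℂ) R, complexMGF X μ z ≠ 0 := fun z hz h0 =>
    hcon ⟨z, mem_ball_zero_iff.mp hz, h0⟩
  exact absurd (variance_le_four_mul_div_of_zeroFree_ball hm hb hR hfree) (not_le.mpr hvar)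

/-- **The nearest zero is at distance at most `4·(half-range)/variance`.**  If `|X − c| ≤ b` a.e.
under a probability measure and `Var X > 0`, the complex MGF of `X` has a zero `z` with
`|z| ≤ 4|b| / Var X`. [ours] -/
theorem exists_zero_norm_le_of_variance_pos (hm : AEMeasurable X μ)
    (hb : ∀ᵐ u ∂μ, |X u - c| ≤ b) (hvar : 0 < variance X μ) :
    ∃ z : ℂ, ‖z‖ ≤ 4 * |b| / variance X μ ∧ complexMGF X μ z = 0 := by
  set v := variance X μ with hv
  set R₀ : ℝ := 4 * |b| / v with hR₀def
  have hR₀ : 0 ≤ R₀ := by positivity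
  by_contra hcon
  push Not at hcon
  have hb0 : ∀ᵐ u ∂μ, |X u| ≤ |c| + b := hb.mono fun u hu => by
    calc |X u| = |(X u - c) + c| := by rw [sub_add_cancel]
      _ ≤ |X u - c| + |c| := abs_add_le _ _
      _ ≤ |c| + b := by linarith
  have hZc : Continuous (complexMGF X μ) :=
    (ZeroPinching.differentiable_complexMGF_of_abs_le hm hb0).continuous
  set K : Set ℂ := closedBall (0 : ℂ) (R₀ + 1) ∩ complexMGF X μ ⁻¹' {0} with hKdef
  have hK : IsCompact K :=
    (isCompact_closedBall (0 : ℂ) (R₀ + 1)).inter_right (isClosed_singleton.preimage hZc)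
  obtain ⟨R₁, hR₁0, hR₁1, hR₁K⟩ : ∃ R₁ : ℝ, R₀ < R₁ ∧ R₁ ≤ R₀ + 1 ∧ ∀ z ∈ K, R₁ ≤ ‖z‖ := by
    rcases K.eq_empty_or_nonempty with hKe | hKne
    · exact ⟨R₀ + 1, by linarith, le_rfl, fun z hz => by simp [hKe] at hz⟩
    · obtain ⟨z₀, hz₀K, hmin⟩ := hK.exists_isMinOn hKne continuous_norm.continuousOn
      refine ⟨min ‖z₀‖ (R₀ + 1), lt_min ?_ (by linarith), min_le_right _ _,
        fun z hz => (min_le_left _ _).trans (hmin hz)⟩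
      by_contra h
      push Not at h
      exact hcon z₀ h hz₀K.2
  have hR₁pos : 0 < R₁ := lt_of_le_of_lt hR₀ hR₁0
  have hlt : 4 * |b| / R₁ < v := by
    rw [div_lt_iff₀ hR₁pos]
    have h4 : 4 * |b| = v * R₀ := by rw [hR₀def]; field_simp
    rw [h4]
    exact mul_lt_mul_of_pos_left hR₁0 hvar
  obtain ⟨z, hz, hz0⟩ := exists_zero_norm_lt_of_lt_variance hm hb hR₁pos hlt
  have hzK : z ∈ K := ⟨mem_closedBall_zero_iff.mpr (hz.le.trans hR₁1), hz0⟩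
  exact absurd (hR₁K z hzK) (not_le.mpr hz)

end General

/-! ## §2 Docked: a Fisher zero of `Z(s) = ∫ D[U] e^{-sS}` within `4·(half-range)/variance` -/

section ActionZ

variable {d L n : ℕ} [NeZero L] {S : AmbConfig d L n → ℝ}

/-- **A Fisher zero within `4·(half-range)/Var`**: for a smooth action with `|S∘ι − c| ≤ b` and
`Var_{D[U]}(S∘ι) > 0`, the partition function `Z(s) = ∫ D[U] e^{-sS}` has a zero `s₀` with
`|s₀| ≤ 4|b| / Var_{D[U]}(S∘ι)`. [ours] -/
theorem exists_actionZ_eq_zero_norm_le (hS : ContDiff ℝ ∞ S) {c b : ℝ}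
    (hb : ∀ U : GaugeConfig d L (Matrix.specialUnitaryGroup (Fin n) ℂ), |S (coeConfig U) - c| ≤ b)
    (hvar : 0 < variance (fun U => S (coeConfig U))
      (trivialMeasure (Matrix.specialUnitaryGroup (Fin n) ℂ) d L)) :
    ∃ s₀ : ℂ, ‖s₀‖ ≤ 4 * |b| / variance (fun U => S (coeConfig U))
        (trivialMeasure (Matrix.specialUnitaryGroup (Fin n) ℂ) d L) ∧
      complexMGF (fun U => -S (coeConfig U))
        (trivialMeasure (Matrix.specialUnitaryGroup (Fin n) ℂ) d L) s₀ = 0 := by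
  have hm : AEMeasurable (fun U => -S (coeConfig U))
      (trivialMeasure (Matrix.specialUnitaryGroup (Fin n) ℂ) d L) :=
    (integrable_trivialMeasure_of_continuous (continuous_comp_coeConfig hS).neg).aemeasurable
  have hb' : ∀ᵐ U ∂(trivialMeasure (Matrix.specialUnitaryGroup (Fin n) ℂ) d L),
      |(-S (coeConfig U)) - (-c)| ≤ b := ae_of_all _ fun U => by
    rw [show -S (coeConfig U) - -c = -(S (coeConfig U) - c) by ring, abs_neg]
    exact hb U
  have hvar' : 0 < variance (fun U => -S (coeConfig U))
      (trivialMeasure (Matrix.specialUnitaryGroup (Fin n) ℂ) d L) := by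
    rw [variance_fun_neg]; exact hvar
  obtain ⟨s₀, hs₀, hz⟩ := exists_zero_norm_le_of_variance_pos hm hb' hvar'
  refine ⟨s₀, ?_, hz⟩
  rw [variance_fun_neg] at hs₀
  exact hs₀

end ActionZ

/-! ## §3 The Wilson action: `|s₀| ≤ 4n/m₂(n)`, i.e. `8` for `SU(2)` and `8n` for `n ≥ 3` -/

section Wilson

variable {d L n : ℕ} [NeZero L]

/-- `|S_W(ιU) − n·#plaquettes| ≤ n·#plaquettes` (`0 ≤ S_W ≤ 2n·#plaquettes`): `n·#plaq` is a centre
and a half-range of the Wilson action. [ours] -/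
theorem abs_ambWilsonAction_sub_le (U : GaugeConfig d L (Matrix.specialUnitaryGroup (Fin n) ℂ)) :
    |ambWilsonAction (coeConfig U) - n * Fintype.card (Plaquette d L)| ≤
      n * Fintype.card (Plaquette d L) := by
  rw [StrongCoupling.ambWilsonAction_coeConfig]
  have h0 := WilsonPinching.wilsonAction_nonneg (StrongCoupling.defRep n) continuous_subtype_val U
  have h1 := WilsonPinching.wilsonAction_le (StrongCoupling.defRep n) continuous_subtype_val U
  rw [abs_le]
  constructor <;> linarith

/-- **Every finite-volume `SU(n)` Wilson partition function has a Fisher zero with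
`|s₀| ≤ 4n/m₂(n)`** (`n ≥ 2`, `d ≥ 2`, every `L ≥ 2`; `m₂(n) = ∫_{SU(n)} (Re tr)² dHaar`). [ours] -/
theorem wilson_exists_fisherZero_norm_le (hd : 2 ≤ d) (hn : 2 ≤ n) (hL : 2 ≤ L) :
    ∃ s₀ : ℂ, ‖s₀‖ ≤ 4 * n /
        ∫ g, ((g : Matrix (Fin n) (Fin n) ℂ)).trace.re ^ 2
          ∂(haarProbability (Matrix.specialUnitaryGroup (Fin n) ℂ)) ∧
      complexMGF (fun U => -ambWilsonAction (coeConfig U))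
        (trivialMeasure (Matrix.specialUnitaryGroup (Fin n) ℂ) d L) s₀ = 0 := by
  set m₂ := ∫ g, ((g : Matrix (Fin n) (Fin n) ℂ)).trace.re ^ 2
    ∂(haarProbability (Matrix.specialUnitaryGroup (Fin n) ℂ)) with hm₂
  set P : ℝ := (Fintype.card (Plaquette d L) : ℝ) with hPdef
  have hm : 0 < m₂ := haarSqReTrace_pos (by omega)
  have hP : 1 ≤ P := by
    rw [hPdef]; exact_mod_cast WilsonPinching.one_le_card_plaquette hd
  have hP0 : 0 < P := by linarith
  have hvarW : variance (fun U => ambWilsonAction (coeConfig U))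
      (trivialMeasure (Matrix.specialUnitaryGroup (Fin n) ℂ) d L) = m₂ * P := by
    rw [wilson_variance_eq hL hn]
  have hvar : 0 < variance (fun U => ambWilsonAction (coeConfig U))
      (trivialMeasure (Matrix.specialUnitaryGroup (Fin n) ℂ) d L) := by
    rw [hvarW]; positivity
  obtain ⟨s₀, hs₀, hz⟩ := exists_actionZ_eq_zero_norm_le (d := d) (L := L) (n := n)
    contDiff_ambWilsonAction (c := n * P) (b := n * P)
    (fun U => by rw [hPdef]; exact abs_ambWilsonAction_sub_le U) hvar
  refine ⟨s₀, ?_, hz⟩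
  rw [hvarW, abs_of_nonneg (by positivity)] at hs₀
  calc ‖s₀‖ ≤ 4 * (n * P) / (m₂ * P) := hs₀
    _ = 4 * n / m₂ := by field_simp

/-- **`SU(2)`: a Fisher zero with `|s₀| ≤ 8`** in every volume (`d ≥ 2`, `L ≥ 2`). [ours] -/
theorem wilson_su2_exists_fisherZero_norm_le (hd : 2 ≤ d) (hL : 2 ≤ L) :
    ∃ s₀ : ℂ, ‖s₀‖ ≤ 8 ∧
      complexMGF (fun U => -ambWilsonAction (coeConfig U))
        (trivialMeasure (Matrix.specialUnitaryGroup (Fin 2) ℂ) d L) s₀ = 0 := by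
  obtain ⟨s₀, hs₀, hz⟩ := wilson_exists_fisherZero_norm_le (d := d) (L := L) (n := 2) hd le_rfl hL
  refine ⟨s₀, ?_, hz⟩
  rw [haarSqReTrace_su2] at hs₀
  have : (4 : ℝ) * (2 : ℕ) / 1 = 8 := by norm_num
  rwa [this] at hs₀

/-- **`SU(n)`, `n ≥ 3`: a Fisher zero with `|s₀| ≤ 8n`** in every volume (`d ≥ 2`, `L ≥ 2`). [ours] -/
theorem wilson_sun_exists_fisherZero_norm_le (hd : 2 ≤ d) (hn : 3 ≤ n) (hL : 2 ≤ L) :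
    ∃ s₀ : ℂ, ‖s₀‖ ≤ 8 * n ∧
      complexMGF (fun U => -ambWilsonAction (coeConfig U))
        (trivialMeasure (Matrix.specialUnitaryGroup (Fin n) ℂ) d L) s₀ = 0 := by
  obtain ⟨s₀, hs₀, hz⟩ :=
    wilson_exists_fisherZero_norm_le (d := d) (L := L) (n := n) hd (by omega) hL
  refine ⟨s₀, ?_, hz⟩
  rw [haarSqReTrace_eq_half hn] at hs₀
  have : (4 : ℝ) * n / (1 / 2) = 8 * n := by ring
  rwa [this] at hs₀

/-- **THEOREM A's volume-uniform radius is at most `4n/m₂(n)`**: every `ρ > 0` admitting a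
volume-uniform geometric gradient bound `|∂^a_e S̃^{(k)}| ≤ C ρ^{-k}` for the Lüscher series of the
`SU(n)` Wilson action (`d ≥ 2`, `n ≥ 2`) satisfies `ρ ≤ 4n/m₂(n)` (COROLLARY F′ with the zero of
`Z_2`). [ours] -/
theorem wilson_theoremA_radius_le_sharp (hd : 2 ≤ d) (hn : 2 ≤ n) {ρ C : ℝ} (hρ : 0 < ρ)
    (hA : ∀ (L : ℕ) [NeZero L] (B : SuBasis n) (Sk : ℕ → AmbConfig d L n → ℝ) (c : ℕ → ℝ),
      (∀ k, ContDiff ℝ ∞ (Sk k)) → IsLuscherSeries B ambWilsonAction Sk c →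
      ∀ (k : ℕ) (U : GaugeConfig d L (Matrix.specialUnitaryGroup (Fin n) ℂ)) (e : Edge d L)
        (a : B.ι), |linkDeriv e (B.T a) (Sk k) (coeConfig U)| ≤ C * ρ⁻¹ ^ k)
    (B : SuBasis n) :
    ρ ≤ 4 * n /
        ∫ g, ((g : Matrix (Fin n) (Fin n) ℂ)).trace.re ^ 2
          ∂(haarProbability (Matrix.specialUnitaryGroup (Fin n) ℂ)) := by
  haveI : NeZero (2 : ℕ) := ⟨by norm_num⟩
  obtain ⟨s₀, hs₀, hz⟩ :=
    wilson_exists_fisherZero_norm_le (d := d) (L := 2) (n := n) hd hn le_rfl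
  exact (wilson_radius_le_norm_of_actionZ_eq_zero hρ hA B 2 hz).trans hs₀

/-- **Lüscher's volume-uniform radius for `SU(2)` is at most `8`.** [ours] -/
theorem wilson_su2_theoremA_radius_le_eight (hd : 2 ≤ d) {ρ C : ℝ} (hρ : 0 < ρ)
    (hA : ∀ (L : ℕ) [NeZero L] (B : SuBasis 2) (Sk : ℕ → AmbConfig d L 2 → ℝ) (c : ℕ → ℝ),
      (∀ k, ContDiff ℝ ∞ (Sk k)) → IsLuscherSeries B ambWilsonAction Sk c →
      ∀ (k : ℕ) (U : GaugeConfig d L (Matrix.specialUnitaryGroup (Fin 2) ℂ)) (e : Edge d L)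
        (a : B.ι), |linkDeriv e (B.T a) (Sk k) (coeConfig U)| ≤ C * ρ⁻¹ ^ k)
    (B : SuBasis 2) : ρ ≤ 8 := by
  have h := wilson_theoremA_radius_le_sharp (d := d) (n := 2) hd le_rfl hρ hA B
  rw [haarSqReTrace_su2] at h
  have : (4 : ℝ) * (2 : ℕ) / 1 = 8 := by norm_num
  rwa [this] at h

/-- **Lüscher's volume-uniform radius for `SU(n)`, `n ≥ 3`, is at most `8n`.** [ours] -/
theorem wilson_sun_theoremA_radius_le_eight_mul (hd : 2 ≤ d) (hn : 3 ≤ n) {ρ C : ℝ} (hρ : 0 < ρ)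
    (hA : ∀ (L : ℕ) [NeZero L] (B : SuBasis n) (Sk : ℕ → AmbConfig d L n → ℝ) (c : ℕ → ℝ),
      (∀ k, ContDiff ℝ ∞ (Sk k)) → IsLuscherSeries B ambWilsonAction Sk c →
      ∀ (k : ℕ) (U : GaugeConfig d L (Matrix.specialUnitaryGroup (Fin n) ℂ)) (e : Edge d L)
        (a : B.ι), |linkDeriv e (B.T a) (Sk k) (coeConfig U)| ≤ C * ρ⁻¹ ^ k)
    (B : SuBasis n) : ρ ≤ 8 * n := by
  have h := wilson_theoremA_radius_le_sharp (d := d) (n := n) hd (by omega) hρ hA B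
  rw [haarSqReTrace_eq_half hn] at h
  have : (4 : ℝ) * n / (1 / 2) = 8 * n := by ring
  rwa [this] at h

end Wilson

/-! ## §4 Appended (lean-2 GEN-7): ANY compact gauge group and matrix representation

For `G` compact with Haar probability, `ρ : G →* Matrix (Fin N) (Fin N) ℂ` continuous and the Wilson
action `S_W(U) = ∑_p (N − Re tr ρ(U_p))` (`0 ≤ S_W ≤ 2N·#plaq`, tree `WilsonPinching`): whenever
`Var_{D[U]}(S_W) > 0` the partition function `Z_L(s) = ∫ D[U] e^{-sS_W}` has a zero with
`|s₀| ≤ 4N·#plaq / Var_{D[U]}(S_W)` — the `U(1)`, `U(N)`, adjoint-`SU(N)`, … cases of §3 at once (the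
variance itself is evaluated in the tree only for the fundamental `SU(n)`, §3). -/

section AnyGroup

variable {d L N : ℕ} [NeZero L] {G : Type*} [Group G] [TopologicalSpace G] [IsTopologicalGroup G]
  [CompactSpace G] [MeasurableSpace G] [BorelSpace G] (ρ : G →* Matrix (Fin N) (Fin N) ℂ)

/-- **A Fisher zero within `4N·#plaq / Var_{D[U]}(S_W)` for every compact gauge group and every
continuous matrix representation** (every `d`, `L`; hypothesis: the β = 0 variance is positive).
[ours] -/
theorem wilsonAction_exists_fisherZero_norm_le (hρ : Continuous ρ)
    (hvar : 0 < variance (wilsonAction ρ) (trivialMeasure G d L)) :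
    ∃ s₀ : ℂ, ‖s₀‖ ≤ 4 * ((N : ℝ) * Fintype.card (Plaquette d L)) /
        variance (wilsonAction ρ) (trivialMeasure G d L) ∧
      complexMGF (fun U => -wilsonAction ρ U) (trivialMeasure G d L) s₀ = 0 := by
  haveI : IsProbabilityMeasure (trivialMeasure G d L) := by
    unfold trivialMeasure; infer_instance
  have hm : AEMeasurable (fun U => -wilsonAction ρ U) (trivialMeasure G d L) :=
    (WilsonRP.measurable_wilsonAction ρ hρ).neg.aemeasurable
  have hb : ∀ᵐ U ∂(trivialMeasure G d L),
      |(-wilsonAction ρ U) - (-((N : ℝ) * Fintype.card (Plaquette d L)))| ≤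
        (N : ℝ) * Fintype.card (Plaquette d L) := ae_of_all _ fun U => by
    have h0 := WilsonPinching.wilsonAction_nonneg ρ hρ U
    have h1 := WilsonPinching.wilsonAction_le ρ hρ U
    rw [abs_le]
    constructor <;> linarith
  have hvar' : 0 < variance (fun U => -wilsonAction ρ U) (trivialMeasure G d L) := by
    rw [variance_fun_neg]; exact hvar
  obtain ⟨s₀, hs₀, hz⟩ := exists_zero_norm_le_of_variance_pos hm hb hvar'
  refine ⟨s₀, ?_, hz⟩
  rw [variance_fun_neg, abs_of_nonneg (by positivity)] at hs₀
  exact hs₀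

/-- The same in Lüscher's integral notation: a zero of
`s ↦ ∫ D[U] e^{-s S_W}` with `|s₀| ≤ 4N·#plaq / Var_{D[U]}(S_W)`. [ours] -/
theorem wilsonZ_exists_zero_norm_le (hρ : Continuous ρ)
    (hvar : 0 < variance (wilsonAction ρ) (trivialMeasure G d L)) :
    ∃ s₀ : ℂ, ‖s₀‖ ≤ 4 * ((N : ℝ) * Fintype.card (Plaquette d L)) /
        variance (wilsonAction ρ) (trivialMeasure G d L) ∧
      ∫ U, cexp (-(s₀ * (wilsonAction ρ U : ℂ))) ∂(trivialMeasure G d L) = 0 := by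
  obtain ⟨s₀, hs₀, hz⟩ := wilsonAction_exists_fisherZero_norm_le (d := d) (L := L) ρ hρ hvar
  exact ⟨s₀, hs₀, by rw [← WilsonPinching.complexMGF_neg_wilsonAction ρ s₀]; exact hz⟩

end AnyGroup

end Summit.Ventures.LatticeQCDFlow.TrivializingMaps
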